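import Summits.QuantumFields.QCD.Theses.SpectralDefectExtinction
import Literature.MathematicalPhysics.QuantumFieldTheory.QCDPhaseQuenched
import Literature.MathematicalPhysics.QuantumFieldTheory.SpectralDefectDensity
import Literature.Barriers.QuantumFields.WilsonDeterminantMassSplitting

/-!
# Stub `haarTransport` of line `Sketch` (skeleton "ResolventCell") for crux
`SpectralDefectExtinction.WegnerEstimate` (item stmt-QuantumFields-8966)

Pure measure theory (transport of a product probability measure along an injective relabelling of
the coordinates): for a probability measure `ν` on `G`, finite index types `ι`, `κ` and an
injective map `f : κ → ι`, the transport map `V ↦ V ∘ f : (ι → G) → (κ → G)` is measure preserving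
from `ν^{⊗ι}` to `ν^{⊗κ}` (the coordinates off the range of `f` are integrated out, `ν univ = 1`).

Proof: by `Measure.pi_eq` it suffices to check measurable boxes `Set.pi univ s`.  The preimage of
such a box under `(· ∘ f)` is the box with sides `Function.extend f s (fun _ => univ)`, i.e. side
`s k` in direction `f k` and full side off the range of `f`; its `ν^{⊗ι}`-measure is
`∏ i, ν (Function.extend f s (fun _ => univ) i) = ∏ k, ν (s k)` by `Measure.pi_pi`,
`Finset.prod_subset` (the factors off the range are `ν univ = 1`) and `Finset.prod_map` along the
embedding `⟨f, hf⟩ : κ ↪ ι`.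
(Adapted from `Literature.Analysis.FunctionSpaces.Torus.map_restrictCoords_volume`, the same
identity for the Haar measures of flat tori.)
-/

noncomputable section

namespace Summit.QuantumFields.QCD.Cruxes.WegnerEstimate.ResolventCell

open MeasureTheory
open scoped Matrix BigOperators
open Literature.MathematicalPhysics.QuantumLattice Literature.MathematicalPhysics.QuantumFieldTheory
  Literature.Probability.LatticeModels
open Literature.Barriers.QuantumFields (isHermitian_gammaFive_mul_wilsonDirac)
open Matrix
open scoped ComplexOrder

/-- The transport map `V ↦ V ∘ f : (ι → G) → (κ → G)` is measurable: each of its coordinates is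
the evaluation at `f k`. -/
theorem haarTransport_measurable {ι κ : Type} {G : Type} [MeasurableSpace G] (f : κ → ι) :
    Measurable fun V : ι → G => V ∘ f :=
  measurable_pi_lambda _ fun k => measurable_pi_apply (f k)

-- adapted from `Literature.Analysis.FunctionSpaces.Torus.map_restrictCoords_volume`
/-- The preimage of a box `Set.pi univ s` under the transport map `V ↦ V ∘ f` (`f` injective) is
the box with sides `Function.extend f s (fun _ => univ)`: side `s k` in direction `f k` and full
side off the range of `f`. -/
theorem haarTransport_preimage_univ_pi {ι κ : Type} {G : Type} (f : κ → ι)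
    (hf : Function.Injective f) (s : κ → Set G) :
    (fun V : ι → G => V ∘ f) ⁻¹' Set.univ.pi s =
      Set.univ.pi (Function.extend f s fun _ => Set.univ) := by
  ext V
  simp only [Set.mem_preimage, Set.mem_univ_pi, Function.comp_apply]
  constructor
  · intro h i
    by_cases hi : ∃ k, f k = i
    · obtain ⟨k, rfl⟩ := hi
      rw [hf.extend_apply]
      exact h k
    · rw [Function.extend_apply' _ _ _ hi]
      exact Set.mem_univ _
  · intro h k
    have := h (f k)
    rwa [hf.extend_apply] at this

/-- For a probability measure `ν` and an injective `f : κ → ι`, the product over `ι` of the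
`ν`-measures of the sides `Function.extend f s (fun _ => univ)` equals `∏ k, ν (s k)`: the factors
off the range of `f` are `ν univ = 1`, and the remaining ones are re-indexed along the embedding
`⟨f, hf⟩ : κ ↪ ι` (`Finset.prod_subset`, `Finset.prod_map`). -/
theorem haarTransport_prod_extend {ι κ : Type} [Fintype ι] [Fintype κ] {G : Type}
    [MeasurableSpace G] (ν : Measure G) [IsProbabilityMeasure ν] (f : κ → ι)
    (hf : Function.Injective f) (s : κ → Set G) :
    ∏ i, ν (Function.extend f s (fun _ => Set.univ) i) = ∏ k, ν (s k) := by
  classical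
  have hone : ∀ i ∈ (Finset.univ : Finset ι), i ∉ Finset.univ.map ⟨f, hf⟩ →
      ν (Function.extend f s (fun _ => Set.univ) i) = 1 := by
    intro i _ hi
    have hi' : ¬∃ k, f k = i := by
      rintro ⟨k, rfl⟩
      exact hi (Finset.mem_map.2 ⟨k, Finset.mem_univ _, rfl⟩)
    rw [Function.extend_apply' _ _ _ hi', measure_univ]
  rw [← Finset.prod_subset (Finset.subset_univ _) hone, Finset.prod_map]
  refine Finset.prod_congr rfl fun k _ => ?_
  show ν (Function.extend f s (fun _ => Set.univ) (f k)) = _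
  rw [hf.extend_apply]

/-- **Stub `haarTransport` (pure measure theory: transport of the product Haar measure along an
injective relabelling of the links).**  For a probability measure `ν` on `G`, finite index types
`ι`, `κ` and an injective `f : κ → ι`, the map `V ↦ V ∘ f` is measure preserving from `ν^{⊗ι}` to
`ν^{⊗κ}`: it is measurable (coordinatewise evaluations), and the push-forward identity is checked
on measurable boxes with `Measure.pi_eq`, `Measure.map_apply`, `Measure.pi_pi`, the coordinates
off the range of `f` contributing factors `ν univ = 1`. -/
theorem stub_haarTransport {ι κ : Type} [Fintype ι] [Fintype κ] {G : Type} [MeasurableSpace G]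
    (ν : Measure G) [IsProbabilityMeasure ν] (f : κ → ι) (hf : Function.Injective f) :
    MeasurePreserving (fun V : ι → G => V ∘ f) (Measure.pi fun _ : ι => ν)
      (Measure.pi fun _ : κ => ν) := by
  refine ⟨haarTransport_measurable f, ?_⟩
  symm
  refine Measure.pi_eq fun s hs => ?_
  rw [Measure.map_apply (haarTransport_measurable f) (MeasurableSet.univ_pi hs),
    haarTransport_preimage_univ_pi f hf, Measure.pi_pi]
  exact haarTransport_prod_extend ν f hf s

end Summit.QuantumFields.QCD.Cruxes.WegnerEstimate.ResolventCell
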